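import Literature.Geometry.Riemannian.SphericalCylinderKernelCertificate
import Literature.Geometry.Riemannian.SphericalCylinderSmallScaleDominationProofs
import HarnessLib

/-!
# Small-scale Gaussian domination for the inclusion `N = S⁴ × ℝ ⊂ ℝ⁶`

Topic `Literature/Geometry/Riemannian`; companion of `SphericalCylinderSmallScaleDomination.lean`
(there: the conformal map `Φ : N → ℝ⁵`) and `SphericalCylinderKernelCertificate.lean`, here for the
INCLUSION `N ↪ ℝ⁶`.  Objects: the round cylinder `N = {z ∈ ℝ⁶ | ∑_{i<5} zᵢ² = 1} = S⁴ × ℝ`, the typed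
kernels `K_{p,σ}`, densities `F̂_{p,σ}` and entropy `λ_cyl = cylEntropy` of `SphericalCylinderEntropy.lean`,
and the Colding–Minicozzi Gaussian areas `F_{y,t}(A) = gaussianArea 4 y t A = (4πt)⁻² ∫_A e^{-‖z-y‖²/4t} dμHE⁴`
of `ColdingMinicozziEntropy.lean`, for `A ⊂ ℝ⁶` and centres `y ∈ ℝ⁶` — the Euclidean Gaussian density
ratios `Θ((y,s), r) = F_{y,r²}(M_{s-r²})` of White's local regularity theorem for `4`-flows in `ℝ⁶`.

THE STATEMENT (`gaussianArea_le_mul_cylEntropy_of_small_scale`, proved; no facts, no definitions):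
for every `δ > 0` there is `r₁ > 0` such that for every measurable `A ⊆ N`, every `y ∈ ℝ⁶` and every
`0 < r ≤ r₁`, `F_{y,r²}(A) ≤ (1 + δ) λ_cyl(A)`: typed thinness dominates the Euclidean density ratios
of subsets of `N` at small scales, with constant `→ 1`.

THE PROOF is a one-kernel certificate for the inclusion, parallel to
`SphericalCylinderConformal.pointwise_domination` (no Jacobian, no slab: the inclusion is an isometry).
Write `y = (ρθ, y₅)`, `θ ∈ S⁴`, `t = r²`; on `N`, `‖z - y‖² = (1-ρ)² + 2ρ(1 - ⟨z', θ⟩) + (z₅ - y₅)²`.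
FAR points (`‖z - y‖² ≥ 4tΛ`, `Λ = log(e⁴/6c₀) - 2 log t`, `4tΛ ≤ ε²` by the tree's `smallness`), and
ALL points when `ρ ≤ 1/2`, see only the area atom `c₀/vol S⁴` (tree `far_bound`,
`measure_ratio_le_cylEntropy_of_subset`); at NEAR points `ρ ≥ 1 - ε` and the tree's `near_angle` gives
`arccos(c)² ≤ (1+κ)((1-ρ)² + 2ρ(1-c))`, so the Cheeger–Yau bound (PROVED in the tree,
`CheegerYauZonalSphereFour_holds`) at the broadened scale `σ = (1+κ)t` dominates the Euclidean kernel by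
`(1+κ)² vol(S⁴)⁻¹ K_{p,σ}`, `p = (θ, y₅)`, of integral `(1+κ)² F̂_{p,σ}(A) ≤ (1+κ)² λ_cyl(A)`; constants
`δ' = min δ 1`, `ε = δ'/40`, `κ = 3ε`, `c₀ = δ'/4` (tree `constants`), `r₁² = (ε²/(16e²(C+4)))²`.

## References
* J. Cheeger, S.-T. Yau, Comm. Pure Appl. Math. 34 (1981) 465–480 [CheegerYau1981]; E. B. Davies,
  *Heat kernels and spectral theory* (1989), Thm 5.6.1 [Davies1989] (the `S⁴` heat kernel bound).
* T. H. Colding, W. P. Minicozzi II, Ann. of Math. 175 (2012) 755–833, §1. [ColdingMinicozzi2012]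
* B. White, *A local regularity theorem for mean curvature flow*, Ann. of Math. 161 (2005)
  1487–1519, §2 (Gaussian density ratios). [White2005]
-/

noncomputable section
open Set Function MeasureTheory MeasureTheory.Measure
open scoped ENNReal NNReal BigOperators
open Literature.Geometry.Manifold.CylinderSlice
open Literature.Geometry.Riemannian.SphericalCylinderEntropy
open Literature.Geometry.Riemannian.SphericalCylinderConformal (near_angle far_bound smallness
  constants gaussianNormalization_four euclideanHausdorffMeasure_sphere_four cylKernel_nonneg_of_mem
  measure_ratio_le_cylEntropy_of_subset)

namespace Literature.Geometry.Riemannian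

namespace SphericalCylinderInclusion

variable {z : EuclideanSpace ℝ (Fin 6)}

/-- `‖z - y‖² = ‖z' - y'‖² + (z₅ - y₅)²` on `ℝ⁶ = ℝ⁵ × ℝ` (`z' = truncL z`; private copy of a
Summits-side coordinate identity, which a Literature file may not import). [folklore] -/
private theorem norm_sub_sq_split (z y : EuclideanSpace ℝ (Fin 6)) :
    ‖z - y‖ ^ 2 = ‖truncL z - truncL y‖ ^ 2 + (z 5 - y 5) ^ 2 := by
  rw [EuclideanSpace.real_norm_sq_eq, EuclideanSpace.real_norm_sq_eq,
    Fin.sum_univ_castSucc (f := fun j : Fin 6 => ((z - y) j) ^ 2)]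
  have h5 : (Fin.last 5 : Fin 6) = 5 := rfl
  simp only [PiLp.sub_apply, truncL_apply, h5]

/-- `‖z'‖ = 1` for `z ∈ N`. [folklore] -/
theorem norm_truncL_of_mem (hz : ∑ i : Fin 5, z (Fin.castSucc i) ^ 2 = 1) :
    ‖truncL z‖ = 1 := by
  rw [EuclideanSpace.norm_eq]
  simp [truncL_apply, Real.norm_eq_abs, sq_abs, hz]

/-- `(1 - ‖w‖)² ≤ ‖z' - w‖²` for `z ∈ N`, `w ∈ ℝ⁵` (reverse triangle inequality, `‖z'‖ = 1`).
[folklore] -/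
theorem sq_one_sub_norm_le (hz : ∑ i : Fin 5, z (Fin.castSucc i) ^ 2 = 1)
    (w : EuclideanSpace ℝ (Fin 5)) : (1 - ‖w‖) ^ 2 ≤ ‖truncL z - w‖ ^ 2 := by
  obtain ⟨h1, h2⟩ := abs_le.1 (abs_norm_sub_norm_le (truncL z) w)
  rw [norm_truncL_of_mem hz] at h1 h2
  exact sq_le_sq' h1 h2

/-- `‖z' - w‖² = (1 - ρ)² + 2ρ(1 - ⟨z', w/ρ⟩)`, `ρ = ‖w‖ > 0`, for `z ∈ N`. [folklore] -/
theorem norm_truncL_sub_sq (hz : ∑ i : Fin 5, z (Fin.castSucc i) ^ 2 = 1)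
    {w : EuclideanSpace ℝ (Fin 5)} (hw : w ≠ 0) :
    ‖truncL z - w‖ ^ 2 =
      (1 - ‖w‖) ^ 2 + 2 * ‖w‖ * (1 - ∑ i : Fin 5, z (Fin.castSucc i) * (‖w‖⁻¹ • w) i) := by
  have hρ : 0 < ‖w‖ := norm_pos_iff.2 hw
  have hw2 : ‖w‖ ^ 2 = ∑ i, w i ^ 2 := EuclideanSpace.real_norm_sq_eq w
  have hS : ∑ i : Fin 5, z (Fin.castSucc i) * (‖w‖⁻¹ • w) i =
      ‖w‖⁻¹ * ∑ i : Fin 5, z (Fin.castSucc i) * w i := by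
    rw [Finset.mul_sum]
    exact Finset.sum_congr rfl fun i _ => by rw [PiLp.smul_apply, smul_eq_mul]; ring
  rw [hS, EuclideanSpace.real_norm_sq_eq]
  have h : ∀ i : Fin 5, ((truncL z - w) i) ^ 2 =
      z (Fin.castSucc i) ^ 2 - 2 * (z (Fin.castSucc i) * w i) + w i ^ 2 := fun i => by
    rw [PiLp.sub_apply, truncL_apply]; ring
  simp only [h, Finset.sum_add_distrib, Finset.sum_sub_distrib, ← Finset.mul_sum, hz, ← hw2]
  field_simp
  ring

/-- The matching cylinder centre `p = (y'/‖y'‖, y₅) ∈ N` of a point `y = (y', y₅) ∈ ℝ⁶` off the axis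
(`y' ≠ 0`): it lies on `N`, its `S⁴`-component is `y'/‖y'‖` and its height is `y₅`. [folklore] -/
theorem center_mem {y : EuclideanSpace ℝ (Fin 6)} (hy : truncL y ≠ 0) :
    (∑ i : Fin 5, (padL (‖truncL y‖⁻¹ • truncL y) + y 5 • axis) (Fin.castSucc i) ^ 2 = 1) ∧
    (∀ i : Fin 5, (padL (‖truncL y‖⁻¹ • truncL y) + y 5 • axis) (Fin.castSucc i) =
      (‖truncL y‖⁻¹ • truncL y) i) ∧
    (padL (‖truncL y‖⁻¹ • truncL y) + y 5 • axis) 5 = y 5 := by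
  set w := truncL y with hw
  have hcoord : ∀ i : Fin 5, (padL (‖w‖⁻¹ • w) + y 5 • axis) (Fin.castSucc i) = (‖w‖⁻¹ • w) i :=
    fun i => by simp [axis, castSucc_ne_five i]
  refine ⟨?_, hcoord, by simp [axis]⟩
  have h1 : ‖(‖w‖⁻¹ • w)‖ = 1 := by
    rw [norm_smul, norm_inv, norm_norm, inv_mul_cancel₀ (norm_pos_iff.2 hy).ne']
  have h2 := EuclideanSpace.real_norm_sq_eq (‖w‖⁻¹ • w)
  rw [h1, one_pow] at h2
  simpa only [hcoord] using h2.symm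

/-- **Near-region comparison for the inclusion `N ⊂ ℝ⁶`.**  In the near region
`Q = (1-ρ)² + 2ρ(1-c) ≤ ε²` (`Q = ‖z' - y'‖²`, `ρ = ‖y'‖ ≥ 0`, `c = ⟨z', y'/ρ⟩ ∈ [-1, 1]`), with
`0 < ε ≤ 1/5`, `κ ≥ 0`, `(1+κ)(1-ε)² ≥ 1`: the squared geodesic distance of `S⁴` is dominated,
`arccos(c)² ≤ (1+κ) Q` (tree `near_angle` with `E = ρ ≥ 1 - ε`). [folklore] -/
theorem near_compare {ε κ ρ c : ℝ} (hε : 0 < ε) (hε5 : ε ≤ 1 / 5) (hκ : 0 ≤ κ)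
    (hκε : 1 ≤ (1 + κ) * (1 - ε) ^ 2) (hc1 : -1 ≤ c) (hc2 : c ≤ 1) (hρ : 0 ≤ ρ)
    (hnear : (1 - ρ) ^ 2 + 2 * ρ * (1 - c) ≤ ε ^ 2) :
    (Real.arccos c) ^ 2 ≤ (1 + κ) * ((1 - ρ) ^ 2 + 2 * ρ * (1 - c)) := by
  have hA0 : 0 ≤ 2 * ρ * (1 - c) := mul_nonneg (mul_nonneg zero_le_two hρ) (by linarith)
  have hρε : (1 - ρ) ^ 2 ≤ ε ^ 2 := by linarith
  obtain ⟨h1, h2⟩ := abs_le_of_sq_le_sq' hρε hε.le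
  have h4 := near_angle hε hε5 (show 1 - ε ≤ ρ by linarith) hc1 hc2 (by linarith [sq_nonneg (1 - ρ)])
  have hκ1 : (0 : ℝ) ≤ 1 + κ := by linarith
  nlinarith [mul_le_mul_of_nonneg_left h4 hκ1, mul_nonneg hκ1 (sq_nonneg (1 - ρ)),
    mul_le_mul_of_nonneg_right hκε (sq_nonneg (Real.arccos c))]

/-- **Near-region kernel bound for the inclusion.**  In the near region, the Euclidean kernel of `ℝ⁶`
restricted to `N`, `(4πt)⁻² e^{-(Q + v²)/4t}` (`Q = ‖z'-y'‖²`, `v = z₅ - y₅`), is at most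
`(1+κ)² (3/8π²) Z e^{-v²/4σ}`, `σ = (1+κ)t`, for any `Z` dominating the Cheeger–Yau minorant
`(8π²/3)(4πσ)⁻² e^{-arccos(c)²/4σ}` (in the application `Z = 𝔥(σ, c)`). [folklore] -/
theorem near_kernel_bound {ε κ t ρ c v Z : ℝ} (hε : 0 < ε) (hε5 : ε ≤ 1 / 5) (hκ : 0 ≤ κ)
    (hκε : 1 ≤ (1 + κ) * (1 - ε) ^ 2) (ht : 0 < t) (hc1 : -1 ≤ c) (hc2 : c ≤ 1) (hρ : 0 ≤ ρ)
    (hnear : (1 - ρ) ^ 2 + 2 * ρ * (1 - c) ≤ ε ^ 2)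
    (hZ : (8 * Real.pi ^ 2 / 3) * ((4 * Real.pi * ((1 + κ) * t)) ^ 2)⁻¹ *
        Real.exp (-(Real.arccos c) ^ 2 / (4 * ((1 + κ) * t))) ≤ Z) :
    ((4 * Real.pi * t) ^ 2)⁻¹ * Real.exp (-((1 - ρ) ^ 2 + 2 * ρ * (1 - c) + v ^ 2) / (4 * t)) ≤
      (1 + κ) ^ 2 * (3 / (8 * Real.pi ^ 2)) * (Z * Real.exp (-(v ^ 2) / (4 * ((1 + κ) * t)))) := by
  have hπ : 0 < Real.pi := Real.pi_pos
  have hκ1 : 0 < 1 + κ := by linarith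
  set σ := (1 + κ) * t with hσ
  have hσpos : 0 < σ := by positivity
  set Q := (1 - ρ) ^ 2 + 2 * ρ * (1 - c) with hQ
  set θ := Real.arccos c with hθ
  have hcmp : θ ^ 2 ≤ (1 + κ) * Q := near_compare hε hε5 hκ hκε hc1 hc2 hρ hnear
  -- the exponents: `(Q + v²)/t ≥ (θ² + v²)/σ`
  have hsum : θ ^ 2 + v ^ 2 ≤ (1 + κ) * (Q + v ^ 2) := by nlinarith [hcmp, sq_nonneg v, hκ]
  have hexp : -(Q + v ^ 2) / (4 * t) ≤ -θ ^ 2 / (4 * σ) + -(v ^ 2) / (4 * σ) := by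
    rw [hσ, ← add_div, div_le_div_iff₀ (by positivity) (by positivity)]
    nlinarith [mul_le_mul_of_nonneg_left hsum (by positivity : (0 : ℝ) ≤ 4 * t)]
  -- the prefactors: `(4πt)⁻² = (1+κ)² (4πσ)⁻²`
  have hpref : ((4 * Real.pi * t) ^ 2)⁻¹ = (1 + κ) ^ 2 * ((4 * Real.pi * σ) ^ 2)⁻¹ := by
    rw [hσ]
    field_simp
  calc ((4 * Real.pi * t) ^ 2)⁻¹ * Real.exp (-(Q + v ^ 2) / (4 * t))
      ≤ ((4 * Real.pi * t) ^ 2)⁻¹ * (Real.exp (-θ ^ 2 / (4 * σ)) * Real.exp (-(v ^ 2) / (4 * σ))) := by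
        rw [← Real.exp_add]
        gcongr
    _ = (1 + κ) ^ 2 * (3 / (8 * Real.pi ^ 2)) * ((8 * Real.pi ^ 2 / 3) * ((4 * Real.pi * σ) ^ 2)⁻¹ *
          Real.exp (-θ ^ 2 / (4 * σ))) * Real.exp (-(v ^ 2) / (4 * σ)) := by
        rw [hpref]
        field_simp
    _ ≤ (1 + κ) ^ 2 * (3 / (8 * Real.pi ^ 2)) * Z * Real.exp (-(v ^ 2) / (4 * σ)) := by gcongr
    _ = _ := by ring

/-- **Pointwise domination for the inclusion `N ⊂ ℝ⁶`.**  Under the smallness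
`16e² t (log(e⁴/6c₀) - 2 log t) ≤ ε²` (written with `t = t e⁰` to match the tree's `far_bound`), for
every Euclidean centre `y ∈ ℝ⁶` there are ONE cylinder centre `p ∈ N` and ONE scale `σ > 0` such that
on `N` the Euclidean kernel
`(4πt)⁻² e^{-‖z - y‖²/4t}` is at most `(1+κ)² vol(S⁴)⁻¹ K_{p,σ}(z) + c₀ vol(S⁴)⁻¹`: far points
(`‖z - y‖² ≥ 4tΛ`) and all points when `‖y'‖ ≤ 1/2` see only the area atom (tree `far_bound` at
height `0`, `t₀ = 0`); near points see the broadened kernel at `p = (y'/‖y'‖, y₅)`, `σ = (1+κ)t`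
(Cheeger–Yau, PROVED in the tree: `CheegerYauZonalSphereFour_holds`). [folklore] -/
theorem pointwise_domination {ε κ c₀ : ℝ} (hε : 0 < ε) (hε5 : ε ≤ 1 / 5) (hκ : 0 ≤ κ)
    (hκε : 1 ≤ (1 + κ) * (1 - ε) ^ 2) (hc₀ : 0 < c₀) {t : ℝ} (ht : 0 < t)
    (hsmall : 16 * Real.exp 2 * (t * Real.exp (-2 * 0)) *
      (Real.log (Real.exp 4 / (6 * c₀)) - 2 * Real.log (t * Real.exp (-2 * 0))) ≤ ε ^ 2)
    (y : EuclideanSpace ℝ (Fin 6)) :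
    ∃ p : EuclideanSpace ℝ (Fin 6), (∑ i : Fin 5, p (Fin.castSucc i) ^ 2 = 1) ∧ ∃ σ : ℝ, 0 < σ ∧
      ∀ z : EuclideanSpace ℝ (Fin 6), (∑ i : Fin 5, z (Fin.castSucc i) ^ 2 = 1) →
        ((4 * Real.pi * t) ^ 2)⁻¹ * Real.exp (-‖z - y‖ ^ 2 / (4 * t)) ≤
          (1 + κ) ^ 2 * (3 / (8 * Real.pi ^ 2)) * cylKernel p σ z + c₀ * (3 / (8 * Real.pi ^ 2)) := by
  have hπ := Real.pi_pos
  -- the far threshold `4tΛ ≤ ε²` (`16 e² t Λ ≤ ε²` and `16e² ≥ 4`)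
  set Λ := Real.log (Real.exp 4 / (6 * c₀)) - 2 * Real.log (t * Real.exp (-2 * 0)) with hΛ
  have hthr : 4 * t * Λ ≤ ε ^ 2 := by
    have he : (1 : ℝ) ≤ Real.exp 2 := Real.one_le_exp (by norm_num)
    have h0 : t * Real.exp (-2 * 0) = t := by rw [mul_zero, Real.exp_zero, mul_one]
    rw [h0] at hsmall
    rcases le_or_gt 0 (t * Λ) with hX | hX
    · nlinarith [mul_le_mul_of_nonneg_right he hX]
    · nlinarith [sq_nonneg ε]
  have hε2 : ε ^ 2 ≤ 1 / 25 := by nlinarith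
  -- the far bound, from the tree's `far_bound` at `s = 0`, `t₀ = 0`
  have hfarb : ∀ z : EuclideanSpace ℝ (Fin 6), 4 * t * Λ ≤ ‖z - y‖ ^ 2 →
      ((4 * Real.pi * t) ^ 2)⁻¹ * Real.exp (-‖z - y‖ ^ 2 / (4 * t)) ≤ c₀ * (3 / (8 * Real.pi ^ 2)) := by
    intro z hfar
    have h := far_bound (s := 0) (t₀ := 0) ht hc₀ (by norm_num) hfar
    simpa using h
  by_cases hy : 1 / 2 < ‖truncL y‖
  · -- centres near `N` in the radial direction matter; match them on `N`
    have hr : 0 < ‖truncL y‖ := lt_trans (by norm_num) hy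
    have hy0 : truncL y ≠ 0 := norm_pos_iff.1 hr
    obtain ⟨hp, hpc, hp5⟩ := center_mem hy0
    have hκ1 : 0 < 1 + κ := by linarith
    set p := padL (‖truncL y‖⁻¹ • truncL y) + y 5 • axis with hp_def
    refine ⟨p, hp, (1 + κ) * t, by positivity, fun z hz => ?_⟩
    have hK0 : 0 ≤ cylKernel p ((1 + κ) * t) z := cylKernel_nonneg_of_mem hp hz (by positivity)
    by_cases hfar : 4 * t * Λ ≤ ‖z - y‖ ^ 2
    · exact (hfarb z hfar).trans (le_add_of_nonneg_left (by positivity))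
    · push Not at hfar
      -- near: decompose the squared distance
      set c := ∑ i : Fin 5, z (Fin.castSucc i) * (‖truncL y‖⁻¹ • truncL y) i with hc_def
      have hPp : ∑ i : Fin 5, z (Fin.castSucc i) * p (Fin.castSucc i) = c :=
        Finset.sum_congr rfl fun i _ => by rw [hpc i]
      have hcabs : |c| ≤ 1 := by rw [← hPp]; exact abs_sum_mul_le_one hz hp
      obtain ⟨hc1, hc2⟩ := abs_le.1 hcabs
      have hsplit := norm_sub_sq_split z y
      have hQ := norm_truncL_sub_sq hz hy0
      have hnear : (1 - ‖truncL y‖) ^ 2 + 2 * ‖truncL y‖ * (1 - c) ≤ ε ^ 2 := by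
        rw [← hc_def] at hQ
        nlinarith [sq_nonneg (z 5 - y 5)]
      have hZ := CheegerYauZonalSphereFour_holds ((1 + κ) * t) (by positivity) c hc1 hc2
      have h := near_kernel_bound (v := z 5 - y 5) hε hε5 hκ hκε ht hc1 hc2 hr.le hnear hZ
      have hK : cylKernel p ((1 + κ) * t) z =
          zonal ((1 + κ) * t) c * Real.exp (-((z 5 - y 5) ^ 2) / (4 * ((1 + κ) * t))) := by
        rw [cylKernel_eq, hPp, hp5]
      rw [hsplit, hQ, ← hc_def, hK]
      exact h.trans (le_add_of_nonneg_right (by positivity))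
  · -- centres far from `N` radially (`‖y'‖ ≤ 1/2`): every point of `N` is far
    push Not at hy
    obtain ⟨p₀, hp₀, -⟩ := exists_center
    refine ⟨p₀, hp₀, 1, one_pos, fun z hz => ?_⟩
    have hK0 : 0 ≤ cylKernel p₀ 1 z := cylKernel_nonneg_of_mem hp₀ hz one_pos
    have hfar : 4 * t * Λ ≤ ‖z - y‖ ^ 2 := by
      have h1 := sq_one_sub_norm_le hz (truncL y)
      have h2 := norm_sub_sq_split z y
      nlinarith [sq_nonneg (z 5 - y 5)]
    exact (hfarb z hfar).trans (le_add_of_nonneg_left (by positivity))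

/-- **A one-kernel certificate for the inclusion integrates.**  If on `N` the Euclidean kernel is
dominated pointwise, `(4πt)⁻² e^{-‖z-y‖²/4t} ≤ c₁ (3/8π²) K_{p,σ}(z) + c₀ (3/8π²)` (`p ∈ N`, `σ > 0`,
`c₁, c₀ ≥ 0`, `3/8π² = 1/vol S⁴`), then for every measurable `A ⊆ N`,
`F_{y,t}(A) = gaussianArea 4 y t A ≤ (c₁ + c₀) λ_cyl(A)`: `vol(S⁴)⁻¹ ∫_A K_{p,σ} dμHE⁴ = F̂_{p,σ}(A) ≤
λ_cyl(A)` and `vol(S⁴)⁻¹ μHE⁴(A) = μH⁴(A)/μH⁴(S⁴) ≤ λ_cyl(A)` (tree `measure_ratio_le_cylEntropy_of_subset`),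
the Haar factor of `μHE⁴ = c μH⁴` on `ℝ⁵` and `ℝ⁶` cancelling (cf. the tree's
`gaussianArea_conformal_le_of_certificate`, whose Steps 2–5 this is, without the Jacobian). [folklore] -/
theorem gaussianArea_le_of_pointwise {c₁ c₀ : ℝ} (hc₁ : 0 ≤ c₁) (hc₀ : 0 ≤ c₀)
    {p : EuclideanSpace ℝ (Fin 6)} (hp : ∑ i : Fin 5, p (Fin.castSucc i) ^ 2 = 1) {σ : ℝ}
    (hσ : 0 < σ) {y : EuclideanSpace ℝ (Fin 6)} {t : ℝ} (ht : 0 < t)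
    (hpt : ∀ z : EuclideanSpace ℝ (Fin 6), (∑ i : Fin 5, z (Fin.castSucc i) ^ 2 = 1) →
      ((4 * Real.pi * t) ^ 2)⁻¹ * Real.exp (-‖z - y‖ ^ 2 / (4 * t)) ≤
        c₁ * (3 / (8 * Real.pi ^ 2)) * cylKernel p σ z + c₀ * (3 / (8 * Real.pi ^ 2)))
    (A : Set (EuclideanSpace ℝ (Fin 6)))
    (hAN : ∀ z ∈ A, ∑ i : Fin 5, z (Fin.castSucc i) ^ 2 = 1) (hAm : MeasurableSet A) :
    gaussianArea 4 y t A ≤ ENNReal.ofReal (c₁ + c₀) * cylEntropy A := by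
  have hπ := Real.pi_pos
  set V' : ℝ := 3 / (8 * Real.pi ^ 2) with hV'
  have hV'0 : 0 < V' := by positivity
  -- Step 2: the pointwise bound in `ℝ≥0∞`
  have hpt' : ∀ z ∈ A, gaussianNormalization 4 t * gaussianWeight y t z ≤
      ENNReal.ofReal (V' * c₀) + ENNReal.ofReal (V' * c₁) * ENNReal.ofReal (cylKernel p σ z) := by
    intro z hz
    have hzN := hAN z hz
    have hK0 : 0 ≤ cylKernel p σ z := cylKernel_nonneg_of_mem hp hzN hσ
    have hle := hpt z hzN
    rw [gaussianNormalization_four ht, gaussianWeight, ← ENNReal.ofReal_mul (by positivity),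
      ← ENNReal.ofReal_mul (by positivity), ← ENNReal.ofReal_add (by positivity) (by positivity)]
    refine ENNReal.ofReal_le_ofReal ?_
    calc ((4 * Real.pi * t) ^ 2)⁻¹ * Real.exp (-(‖z - y‖ ^ 2) / (4 * t))
        ≤ c₁ * V' * cylKernel p σ z + c₀ * V' := hle
      _ = V' * c₀ + V' * c₁ * cylKernel p σ z := by ring
  -- Step 3: integrate
  have step2 : ∫⁻ z in A, gaussianNormalization 4 t * gaussianWeight y t z ∂μHE[4] ≤
      ENNReal.ofReal (V' * c₀) * μHE[4] A +
        ENNReal.ofReal (V' * c₁) * ∫⁻ z in A, ENNReal.ofReal (cylKernel p σ z) ∂μHE[4] := by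
    calc ∫⁻ z in A, gaussianNormalization 4 t * gaussianWeight y t z ∂μHE[4]
        ≤ ∫⁻ z in A, (ENNReal.ofReal (V' * c₀) +
            ENNReal.ofReal (V' * c₁) * ENNReal.ofReal (cylKernel p σ z)) ∂μHE[4] :=
          setLIntegral_mono' hAm hpt'
      _ = _ := by
          rw [lintegral_add_left measurable_const, setLIntegral_const,
            lintegral_const_mul' _ _ ENNReal.ofReal_ne_top]
  -- Step 4: from `μHE⁴` to the typed `μH⁴` ratios (the Haar factor `cH` cancels)
  set cH : ℝ≥0∞ := ((Measure.addHaarScalarFactor (volume : Measure (EuclideanSpace ℝ (Fin 4)))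
      (μH[((4 : ℕ) : ℝ)] : Measure (EuclideanSpace ℝ (Fin 4))) : ℝ≥0) : ℝ≥0∞) with hcH_def
  have hcH0 : cH ≠ 0 :=
    ENNReal.coe_ne_zero.2 (Measure.addHaarScalarFactor_volume_hausdorffMeasure_ne_zero 4)
  have hcHtop : cH ≠ ⊤ := ENNReal.coe_ne_top
  set S : ℝ≥0∞ := μH[4] (Metric.sphere (0 : EuclideanSpace ℝ (Fin 5)) 1) with hS_def
  have hμA : (μHE[4] : Measure (EuclideanSpace ℝ (Fin 6))) A = cH * μH[4] A := by
    rw [Measure.euclideanHausdorffMeasure_def, Measure.smul_apply, ENNReal.smul_def, smul_eq_mul]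
    rfl
  have hIK := setLIntegral_euclideanHausdorffMeasure_eq_mul 4 (fun z => ENNReal.ofReal (cylKernel p σ z)) A
  have hS : (μHE[4] : Measure (EuclideanSpace ℝ (Fin 5))) (Metric.sphere (0 : EuclideanSpace ℝ (Fin 5)) 1) =
      cH * S := by
    rw [Measure.euclideanHausdorffMeasure_def, Measure.smul_apply, ENNReal.smul_def, smul_eq_mul]
    rfl
  have hV : ENNReal.ofReal V' = cH⁻¹ * S⁻¹ := by
    rw [hV', show (3 / (8 * Real.pi ^ 2) : ℝ) = (8 * Real.pi ^ 2 / 3)⁻¹ by field_simp,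
      ENNReal.ofReal_inv_of_pos (by positivity), ← euclideanHausdorffMeasure_sphere_four, hS,
      ENNReal.mul_inv (Or.inl hcH0) (Or.inl hcHtop)]
  have hcancel : ∀ X : ℝ≥0∞, cH⁻¹ * S⁻¹ * (cH * X) = S⁻¹ * X := fun X => by
    rw [mul_mul_mul_comm, ENNReal.inv_mul_cancel hcH0 hcHtop, one_mul]
  -- Step 5: the two atoms are bounded by the cylinder entropy
  have hatom0 : ENNReal.ofReal V' * (μHE[4] : Measure (EuclideanSpace ℝ (Fin 6))) A ≤ cylEntropy A := by
    rw [hV, hμA, hcancel]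
    exact measure_ratio_le_cylEntropy_of_subset hAm hAN
  have hatom1 : ENNReal.ofReal V' * ∫⁻ z in A, ENNReal.ofReal (cylKernel p σ z) ∂μHE[4] ≤
      cylEntropy A := by
    rw [hV, hIK, hcancel]
    have hdens : cylDensity A p σ ≤ cylEntropy A :=
      le_iSup_of_le p (le_iSup_of_le hp (le_iSup_of_le σ (le_iSup_of_le hσ le_rfl)))
    exact hdens
  calc gaussianArea 4 y t A
      = ∫⁻ z in A, gaussianNormalization 4 t * gaussianWeight y t z ∂μHE[4] := by
        rw [gaussianArea_eq, lintegral_const_mul' _ _ (gaussianNormalization_ne_top 4 t)]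
    _ ≤ ENNReal.ofReal (V' * c₀) * μHE[4] A +
          ENNReal.ofReal (V' * c₁) * ∫⁻ z in A, ENNReal.ofReal (cylKernel p σ z) ∂μHE[4] := step2
    _ = ENNReal.ofReal c₀ * (ENNReal.ofReal V' * (μHE[4] : Measure (EuclideanSpace ℝ (Fin 6))) A) +
          ENNReal.ofReal c₁ *
            (ENNReal.ofReal V' * ∫⁻ z in A, ENNReal.ofReal (cylKernel p σ z) ∂μHE[4]) := by
        rw [mul_comm V' c₀, mul_comm V' c₁, ENNReal.ofReal_mul hc₀, ENNReal.ofReal_mul hc₁, mul_assoc,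
          mul_assoc]
    _ ≤ ENNReal.ofReal c₀ * cylEntropy A + ENNReal.ofReal c₁ * cylEntropy A := by gcongr
    _ = ENNReal.ofReal (c₁ + c₀) * cylEntropy A := by
        rw [← add_mul, ← ENNReal.ofReal_add hc₀ hc₁, add_comm c₀]

/-! ### The domination theorem -/

/-- **Small-scale Gaussian domination for the inclusion `N ⊂ ℝ⁶`.**  For every `δ > 0` there is
`r₁ > 0` such that `F_{y,r²}(A) = gaussianArea 4 y (r²) A ≤ (1+δ) λ_cyl(A)` for all measurable
`A ⊆ N = {z ∈ ℝ⁶ | ∑_{i<5} zᵢ² = 1}`, all centres `y ∈ ℝ⁶` and all radii `0 < r ≤ r₁`: the Euclidean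
Gaussian density ratios of a subset of `N`, at scales below `r₁`, are dominated by its typed cylinder
entropy.  Constants as in the tree's conformal domination: `δ' = min δ 1`, `ε = δ'/40`, `κ = 3ε`,
`c₀ = δ'/4`, `C = log(e⁴/6c₀)`, and `r₁² = (ε²/(16e²(C+4)))²` makes the near region `4tΛ ≤ ε²`
small (tree `smallness`); then `pointwise_domination` and `gaussianArea_le_of_pointwise` give the mass
`(1+κ)² + c₀ ≤ 1 + δ'` (tree `constants`). [folklore] -/
theorem gaussianArea_le_mul_cylEntropy_of_small_scale :
    ∀ δ : ℝ, 0 < δ → ∃ r₁ : ℝ, 0 < r₁ ∧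
      ∀ A : Set (EuclideanSpace ℝ (Fin 6)), (∀ z ∈ A, ∑ i : Fin 5, z (Fin.castSucc i) ^ 2 = 1) →
        MeasurableSet A → ∀ (y : EuclideanSpace ℝ (Fin 6)) (r : ℝ), 0 < r → r ≤ r₁ →
          gaussianArea 4 y (r ^ 2) A ≤ ENNReal.ofReal (1 + δ) * cylEntropy A := by
  intro δ hδ
  have hδ'0 : 0 < min δ 1 := lt_min hδ one_pos
  have hδ'1 : min δ 1 ≤ 1 := min_le_right _ _
  have hδ'δ : min δ 1 ≤ δ := min_le_left _ _
  obtain ⟨hε5, hκε, htot⟩ := constants hδ'0 hδ'1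
  set δ' := min δ 1 with hδ'
  set ε := δ' / 40 with hε_def
  set κ := 3 * ε with hκ_def
  set c₀ := δ' / 4 with hc₀_def
  have hε : 0 < ε := by positivity
  have hε1 : ε ≤ 1 := by linarith
  have hκ : 0 ≤ κ := by positivity
  have hc₀ : 0 < c₀ := by positivity
  have hπ := Real.pi_pos
  set C := Real.log (Real.exp 4 / (6 * c₀)) with hC_def
  have hC : 0 ≤ C := by
    refine Real.log_nonneg ?_
    rw [le_div_iff₀ (by positivity)]
    have : (4 : ℝ) + 1 ≤ Real.exp 4 := Real.add_one_le_exp 4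
    linarith
  set t₁ := (ε ^ 2 / (16 * Real.exp 2 * (C + 4))) ^ 2 with ht₁
  have ht₁0 : 0 < t₁ := by positivity
  refine ⟨Real.sqrt t₁, Real.sqrt_pos.2 ht₁0, ?_⟩
  intro A hAN hAm y r hr hrle
  have ht : 0 < r ^ 2 := by positivity
  -- smallness of the near region at `T = r² ≤ t₁`
  have h0 : r ^ 2 * Real.exp (-2 * 0) = r ^ 2 := by rw [mul_zero, Real.exp_zero, mul_one]
  have hTle : r ^ 2 * Real.exp (-2 * 0) ≤ t₁ := by
    calc r ^ 2 * Real.exp (-2 * 0) = r ^ 2 := h0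
      _ ≤ (Real.sqrt t₁) ^ 2 := pow_le_pow_left₀ hr.le hrle 2
      _ = t₁ := Real.sq_sqrt ht₁0.le
  have hsmall : 16 * Real.exp 2 * (r ^ 2 * Real.exp (-2 * 0)) *
      (Real.log (Real.exp 4 / (6 * c₀)) - 2 * Real.log (r ^ 2 * Real.exp (-2 * 0))) ≤ ε ^ 2 := by
    have h := smallness (h0.symm ▸ ht) hε hε1 hC hTle
    have h2 : C + 2 * Real.log (1 / (r ^ 2 * Real.exp (-2 * 0))) =
        Real.log (Real.exp 4 / (6 * c₀)) - 2 * Real.log (r ^ 2 * Real.exp (-2 * 0)) := by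
      rw [one_div, Real.log_inv, hC_def]; ring
    rwa [h2] at h
  obtain ⟨p, hp, σ, hσ, hpt⟩ := pointwise_domination hε hε5 hκ hκε hc₀ ht hsmall y
  have hmain := gaussianArea_le_of_pointwise (c₁ := (1 + κ) ^ 2) (by positivity) hc₀.le hp hσ ht hpt
    A hAN hAm
  -- the total mass `(1+κ)² + c₀ ≤ (1 + c₀)(e^{4ε}(1+κ)² + c₀) ≤ 1 + δ' ≤ 1 + δ`
  have hmass : (1 + κ) ^ 2 + c₀ ≤ 1 + δ := by
    have he : 1 ≤ Real.exp (4 * ε) := Real.one_le_exp (by positivity)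
    have hb : 0 ≤ Real.exp (4 * ε) * (1 + κ) ^ 2 + c₀ := by positivity
    nlinarith [mul_nonneg hc₀.le hb, mul_le_mul_of_nonneg_right he (sq_nonneg (1 + κ))]
  calc gaussianArea 4 y (r ^ 2) A ≤ ENNReal.ofReal ((1 + κ) ^ 2 + c₀) * cylEntropy A := hmain
    _ ≤ ENNReal.ofReal (1 + δ) * cylEntropy A := by
        gcongr

end SphericalCylinderInclusion

end Literature.Geometry.Riemannian

end
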